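import Summits.QuantumFields.YangMills.Theorems.FluctuationComparisonRegPrIntLSectionTubeSplit
import Summits.QuantumFields.YangMills.Theorems.FluctuationComparisonRegPrIntLHaarTubeOneStep
import HarnessLib

/-!
# `FluctuationComparisonRegPrIntLSmallMassOneStep` — ⟨SMALL-MASS₁(S′)⟩, the one-step Haar letter of the σ-FREE persistence road, FROM the `Sfine`-relative tube
# charge for GEOM∘'s section and the Haar floor of the UV-small history (crux `FluctuationComparisonRegPrIntL`, stmt-QuantumFields-20520; LINE g22-4 ∕ g22-5,
# row PERS₁∘ via LEAD w3-20520 g18's σ-free knit `…PersistenceSigmaFree`)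

Cell `ym3-torus` (YM ladder rung R3 = continuum SU(2) Yang–Mills on T³ — a RUNG, NOT d = 4, NOT infinite volume, NOT a mass gap, NOT Clay);
width seat `ym3-torus-px8` (gen 14), explicit-unit helper; `--supports stmt-QuantumFields-20520 --as helper`.  THEOREMS ONLY (0 `def`, 0 `sorry`,
default heartbeats).

WHAT.  The σ-free road (px8 g14 06:36:55Z, LEAD w3-20520 g18 06:48:27Z CONFIRMED, knit `…PersistenceSigmaFree`): PERS₁∘ ⟸ ⟨UP⟩ + ⟨LOW on S′⟩ + ⟨SMALL-MASS₁(S′)⟩,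
`S′ := {PlaqSmall θ_{J+1}(c·b₀)}` the level-`(J+1)` INTERIOR window, ⟨SMALL-MASS₁(S′)⟩ = «`q₀·dU_{J+1}(D⁻¹B) ≤ dU_{J+1}(D⁻¹B ∩ S′)` for measurable `B ⊆ W_J(c·b₀)`,
`q₀` after `F, γ, J`».  THIS FILE closes ⟨SMALL-MASS₁(S′)⟩ MODULO two K-FREE letters whose suppliers exist or are claimed, WITHOUT a second chart road: the section
re-enters only as a TOOL —
* GEOM∘ ✓`…InteriorSectionMeasurable.interiorSectionCan` (p763878, imported, used BY NAME): a measurable section `σ` of `D = D_{J,J+1}` over `W_J(c·b₀)` with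
  margin `plaq(σ U) < θ_{J+1}(c·b₀) − 4r`;
* ⟨HAAR-TUBE₁-REL⟩ (hypothesis `hrel`): for every such section, `∃ q₁ > 0`, `ofReal q₁·dU(D⁻¹B ∩ Sfine) ≤ dU(D⁻¹B ∩ Sfine ∩ T_σ)` for measurable `B ⊆ W_J(c·b₀)`,
  `Sfine := histGood F ℰp (θBal F.L γ b₀ p₀) (J+1) J`, `T_σ := {V | ∀ b, dist1 ((σ (D V) b)⁻¹·V b) < r}` — the output currency of px8's chart door
  ✓`…HaarTubeOneStep(Compact)` (p764111 ∕ p764434) ∘ w4-20520 g18's engine ✓`…HaarTubeLscFloor.hfib_of_pos` (p764381) ∘ px20 g11's LOCAL charge (claimed);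
* ⟨FLOOR₁⟩ (hypothesis `hfloor`, px20 g11 FILE E `haarFloor_histGood_depthOne` VERBATIM): `∃ q₂ > 0`, `ofReal q₂·dU(D⁻¹B) ≤ dU(D⁻¹B ∩ Sfine)` for measurable
  `B ⊆ W_J(c·b₀)`, `0 < c < 1`.
Then `D⁻¹B ∩ Sfine ∩ T_σ ⊆ D⁻¹B ∩ S′` by the margin (LEAD's ✓`plaqSmall_of_linkTube`) and `q₀ := q₁·q₂`:
* §1 ★ `mul_measure_le_inter_of_relTube_floor` (measure arithmetic, any measure space);
* §2 ★ `preimage_inter_tube_subset_window` (the inclusion from the margin);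
* §3 ★★★ `smallMassInterior_of_haarTubeRel_floor` — ⟨SMALL-MASS₁(S′)⟩ IN THE ORGAN'S SHARED SHAPE (prefix `∀ L ∃ c₀ ∀ c ∃ pS ∀ b₀ p₀ ∃ γ₁ ∀ F γ ∀ J ∃ q₀ …`;
  `c₀ := min (min c₀ᴳ c₀ʳ) ½` so `c < 1` for ⟨FLOOR₁⟩, `pS := max`, `γ₁ := min` of the three suppliers');
* §4 (v1.1) THE UFL₁ ROAD (LEAD w3-20520 g18 06:54:47Z): ★★ `numFloor_of_chartwise` (an ABSOLUTE numerator floor `ofReal m·dU_J(B) ≤ dU_K(D⁻¹B ∩ Sfine ∩ G)` from a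
  chartwise lower bound `ofReal m ≤ ∫⁻ 1_{G ∩ Sfine}(Φ)·jac`), ★ `mul_measure_le_inter_of_numFloor_ufl`, ★★★ `smallMassInterior_of_numFloor_ufl` — ⟨SMALL-MASS₁(S′)⟩ ⟸
  ⟨NUM-FLOOR₁(S′)⟩ + UFL₁ (✓-to-be `…UpperFibreLawOneStep.haar_preimage_descendTo_succ_le`, hypothesis-free), `q₀ := m₀∕C`.

HONEST SCOPE.  A knit over landed∕claimed K-FREE letters; ⟨HAAR-TUBE₁-REL⟩'s pointwise charge (px20 LOCAL) and ⟨FLOOR₁⟩ (px20 FILE E) are HYPOTHESES here; ⟨UP⟩∕⟨LOW⟩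
([Balaban1985UV3] (7), K-uniform, XL) untouched; ⟨SMALL-MASS₁⟩ unconditional only when both letters land; PERS₁∘, POS∘, LFR♯ᶜ∘, S2β, 20520 and every rung statement
NOT proved; `YM3TorusSU2` NOT proved; the Yang–Mills mass gap (Clay) NOT proved.

References: T. Bałaban, Commun. Math. Phys. **98** (1985) 17–51 [Balaban1985Averaging] ((10) p. 19, Prop. 1 p. 22); CMP **102** (1985) 255–275
[Balaban1985UV3] ((7) p. 257, (38)–(40) p. 266); CMP **109** (1987) 249–301 [Balaban1987RG1] ((0.4) p. 253, (0.18)–(0.22) p. 255).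
-/

set_option autoImplicit false

noncomputable section

open MeasureTheory Set
open scoped ENNReal NNReal
open Literature.MathematicalPhysics.QuantumFieldTheory.Balaban1983to89
open Literature.MathematicalPhysics.QuantumFieldTheory.Balaban1983to89.T3ContinuumYM3Torus
open Literature.MathematicalPhysics.QuantumFieldTheory.Balaban1983to89.T3UnitLawDensityEML
open Literature.MathematicalPhysics.QuantumFieldTheory.Balaban1983to89.T3UnitScaleTilt
open Literature.MathematicalPhysics.QuantumFieldTheory.Balaban1983to89.T3TiltDescent
open scoped Literature.MathematicalPhysics.QuantumFieldTheory.Balaban1983to89.T3OrbitAverage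
open Summit.QuantumFields.YangMills.Theorems.FluctuationComparisonRegPrIntLSectionTubeSplit (plaqSmall_of_linkTube)
open Summit.QuantumFields.YangMills.Theorems.FluctuationComparisonRegPrIntLInteriorSectionMeasurable (interiorSectionCan)
open Summit.QuantumFields.YangMills.Theorems.FluctuationComparisonRegPrIntLWregGlue (WindowChart)

namespace Summit.QuantumFields.YangMills.Theorems.FluctuationComparisonRegPrIntLSmallMassOneStep

/-! ## §1 Measure arithmetic: relative charge of a target-bound tube + floor ⇒ charge of the target -/

section Arith

variable {X : Type*} [MeasurableSpace X]

/-- ★ **RELATIVE TUBE CHARGE + FLOOR + TARGET INCLUSION ⇒ CHARGE OF THE TARGET**: `ofReal q₁·μ(A ∩ S) ≤ μ(A ∩ S ∩ T)`, `ofReal q₂·μ(A) ≤ μ(A ∩ S)` (`q₁ ≥ 0`) and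
`A ∩ S ∩ T ⊆ A ∩ S′` give `ofReal(q₁·q₂)·μ(A) ≤ μ(A ∩ S′)` (outer measures; no measurability needed). [folklore] -/
theorem mul_measure_le_inter_of_relTube_floor (μ : Measure X) {A S T S' : Set X} {q₁ q₂ : ℝ} (hq₁ : 0 ≤ q₁)
    (hincl : A ∩ S ∩ T ⊆ A ∩ S') (hrel : ENNReal.ofReal q₁ * μ (A ∩ S) ≤ μ (A ∩ S ∩ T))
    (hfloor : ENNReal.ofReal q₂ * μ A ≤ μ (A ∩ S)) :
    ENNReal.ofReal (q₁ * q₂) * μ A ≤ μ (A ∩ S') :=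
  calc ENNReal.ofReal (q₁ * q₂) * μ A = ENNReal.ofReal q₁ * (ENNReal.ofReal q₂ * μ A) := by
        rw [ENNReal.ofReal_mul hq₁, mul_assoc]
    _ ≤ ENNReal.ofReal q₁ * μ (A ∩ S) := mul_le_mul' le_rfl hfloor
    _ ≤ μ (A ∩ S ∩ T) := hrel
    _ ≤ μ (A ∩ S') := measure_mono hincl

end Arith

/-! ## §2 The inclusion from the section's plaquette margin -/

section Inclusion

variable (F : T3Family) {J : ℕ}

/-- ★ **A TUBE AROUND A MARGIN SECTION LIES IN THE INTERIOR WINDOW**: if `σ` has `plaq(σ U) < θ′ − 4r` for every `U ∈ W`, then for `B ⊆ W` and any fine set `Sfine`: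
`D⁻¹B ∩ Sfine ∩ {V | ∀ b, dist1 ((σ (D V) b)⁻¹·V b) < r} ⊆ D⁻¹B ∩ {V | PlaqSmall θ′ V}` (LEAD's ✓`plaqSmall_of_linkTube`, lit ✓`plaqSmall_of_bdev_le`).
[cite: Balaban1985Averaging, (19) p.21; Balaban1987RG1, (0.18) p.255] -/
theorem preimage_inter_tube_subset_window
    {W : Set (GaugeField (F.P J) 0 (Matrix.specialUnitaryGroup (Fin 2) ℂ))} {θ' r : ℝ}
    (σ : GaugeField (F.P J) 0 (Matrix.specialUnitaryGroup (Fin 2) ℂ) → GaugeField (F.P (J + 1)) 0 (Matrix.specialUnitaryGroup (Fin 2) ℂ))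
    (hσ : ∀ U ∈ W, PlaqSmall (θ' - 4 * r) (σ U))
    {B : Set (GaugeField (F.P J) 0 (Matrix.specialUnitaryGroup (Fin 2) ℂ))} (hBW : B ⊆ W)
    (Sfine : Set (GaugeField (F.P (J + 1)) 0 (Matrix.specialUnitaryGroup (Fin 2) ℂ))) :
    descendTo F ℰp J (J + 1) (Nat.le_succ J) ⁻¹' B ∩ Sfine ∩
        {V | ∀ b : PBond (F.P (J + 1)) 0, dist1 ((σ (descendTo F ℰp J (J + 1) (Nat.le_succ J) V) b)⁻¹ * V b) < r} ⊆
      descendTo F ℰp J (J + 1) (Nat.le_succ J) ⁻¹' B ∩ {V | PlaqSmall θ' V} := by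
  rintro V ⟨⟨hVB, -⟩, hVT⟩
  exact ⟨hVB, plaqSmall_of_linkTube (hσ _ (hBW hVB)) hVT⟩

end Inclusion

/-! ## §3 ⟨SMALL-MASS₁(S′)⟩ in the organ's shared shape -/

section Knit

/-- ★★★ **⟨SMALL-MASS₁(S′)⟩ ⟸ GEOM∘ (✓, by name) + ⟨HAAR-TUBE₁-REL for margin sections⟩ + ⟨FLOOR₁⟩.**  In the organ's shared shape: for every `L` there are
`c₀ ∈ (0, 1]`, and for `0 < c ≤ c₀` a `pS`, and for `b₀ > 0`, `pS ≤ p₀`, `p₀ > 0` a `γ₁ > 0`, such that for every family `F` (`F.L = L`), `0 < γ ≤ γ₁` and level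
`J` there is `q₀ > 0` with `ofReal q₀·dU_{J+1}(D⁻¹B) ≤ dU_{J+1}(D⁻¹B ∩ {PlaqSmall θ_{J+1}(c·b₀)})` for every measurable `B ⊆ W_J(c·b₀)` — the ⟨SMALL-MASS₁(S′)⟩ letter of
✓`…PersistenceSigmaFree.oneLevelPersistenceIntCan_of_up_low_smallMass` TOKEN FOR TOKEN.  HYPOTHESES: `hrel` = the `Sfine`-relative one-step tube charge for MEASURABLE
sections WITH margin (`Sfine = histGood F ℰp (θBal F.L γ b₀ p₀) (J+1) J`; output currency of ✓`…HaarTubeOneStep` ∘ ✓`…HaarTubeLscFloor.hfib_of_pos` ∘ a pointwise charge), in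
the shared shape; `hfloor` = px20 g11's `haarFloor_histGood_depthOne` VERBATIM.  PROOF: `c₀ := min (min c₀ᴳ c₀ʳ) ½` (so `c < 1`), `pS := max pSᴳ pSʳ`,
`γ₁ := min γ₁ᴳ (min γ₁ʳ γ₁ᶠ)`; GEOM∘ ✓`interiorSectionCan` supplies `r, σ`; `q₀ := q₁·q₂`; §2 + §1.  HONEST SCOPE: a knit; both letters are hypotheses; ⟨UP⟩∕⟨LOW⟩, PERS₁∘,
20520 NOT proved. [cite: Balaban1985Averaging, (10) p.19 and Prop. 1 p.22; Balaban1985UV3, (7) p.257 and (38)-(40) p.266; Balaban1987RG1, (0.4) p.253 and (0.18) p.255] -/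
theorem smallMassInterior_of_haarTubeRel_floor
    (hrel : ∀ (L : ℕ), ∃ c₀ : ℝ, 0 < c₀ ∧ c₀ ≤ 1 ∧ ∀ (c : ℝ), 0 < c → c ≤ c₀ → ∃ pS : ℝ, ∀ (b₀ p₀ : ℝ), 0 < b₀ → pS ≤ p₀ → 0 < p₀ →
      ∃ γ₁ : ℝ, 0 < γ₁ ∧ ∀ (F : T3Family) (γ : ℝ), F.L = L → 0 < γ → γ ≤ γ₁ →
        ∀ (J : ℕ) (r : ℝ), 0 < r →
          ∀ σ : GaugeField (F.P J) 0 (Matrix.specialUnitaryGroup (Fin 2) ℂ) → GaugeField (F.P (J + 1)) 0 (Matrix.specialUnitaryGroup (Fin 2) ℂ),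
            Measurable σ →
            (∀ U : GaugeField (F.P J) 0 (Matrix.specialUnitaryGroup (Fin 2) ℂ), PlaqSmall (θBal F.L γ (c * b₀) p₀ J) U →
              descendTo F ℰp J (J + 1) (Nat.le_succ J) (σ U) = U ∧ PlaqSmall (θBal F.L γ (c * b₀) p₀ (J + 1) - 4 * r) (σ U)) →
            ∃ q₁ : ℝ, 0 < q₁ ∧ ∀ (B : Set (GaugeField (F.P J) 0 (Matrix.specialUnitaryGroup (Fin 2) ℂ))), MeasurableSet B →
              B ⊆ {U | PlaqSmall (θBal F.L γ (c * b₀) p₀ J) U} →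
              ENNReal.ofReal q₁ * fieldMeasure (F.P (J + 1)) 0 (Matrix.specialUnitaryGroup (Fin 2) ℂ)
                  (descendTo F ℰp J (J + 1) (Nat.le_succ J) ⁻¹' B ∩ histGood F ℰp (θBal F.L γ b₀ p₀) (J + 1) J) ≤
                fieldMeasure (F.P (J + 1)) 0 (Matrix.specialUnitaryGroup (Fin 2) ℂ)
                  (descendTo F ℰp J (J + 1) (Nat.le_succ J) ⁻¹' B ∩ histGood F ℰp (θBal F.L γ b₀ p₀) (J + 1) J ∩
                    {V | ∀ b : PBond (F.P (J + 1)) 0, dist1 ((σ (descendTo F ℰp J (J + 1) (Nat.le_succ J) V) b)⁻¹ * V b) < r}))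
    (hfloor : ∀ (L : ℕ) (b₀ p₀ : ℝ), 0 < b₀ → 0 < p₀ → ∃ γ₁ : ℝ, 0 < γ₁ ∧ ∀ (F : T3Family) (γ : ℝ), F.L = L → 0 < γ → γ ≤ γ₁ →
      ∀ (J : ℕ) (c : ℝ), 0 < c → c < 1 →
        ∃ q : ℝ, 0 < q ∧ ∀ B : Set (GaugeField (F.P J) 0 (Matrix.specialUnitaryGroup (Fin 2) ℂ)), MeasurableSet B →
          B ⊆ {U | PlaqSmall (θBal F.L γ (c * b₀) p₀ J) U} →
          ENNReal.ofReal q * fieldMeasure (F.P (J + 1)) 0 (Matrix.specialUnitaryGroup (Fin 2) ℂ) (descendTo F ℰp J (J + 1) (Nat.le_succ J) ⁻¹' B) ≤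
            fieldMeasure (F.P (J + 1)) 0 (Matrix.specialUnitaryGroup (Fin 2) ℂ)
              (descendTo F ℰp J (J + 1) (Nat.le_succ J) ⁻¹' B ∩ histGood F ℰp (θBal F.L γ b₀ p₀) (J + 1) J)) :
    ∀ (L : ℕ), ∃ c₀ : ℝ, 0 < c₀ ∧ c₀ ≤ 1 ∧ ∀ (c : ℝ), 0 < c → c ≤ c₀ → ∃ pS : ℝ, ∀ (b₀ p₀ : ℝ), 0 < b₀ → pS ≤ p₀ → 0 < p₀ →
      ∃ γ₁ : ℝ, 0 < γ₁ ∧ ∀ (F : T3Family) (γ : ℝ), F.L = L → 0 < γ → γ ≤ γ₁ →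
        ∀ (J : ℕ), ∃ q₀ : ℝ, 0 < q₀ ∧ ∀ (B : Set (GaugeField (F.P J) 0 (Matrix.specialUnitaryGroup (Fin 2) ℂ))), MeasurableSet B →
          B ⊆ {U | PlaqSmall (θBal F.L γ (c * b₀) p₀ J) U} →
          ENNReal.ofReal q₀ * fieldMeasure (F.P (J + 1)) 0 (Matrix.specialUnitaryGroup (Fin 2) ℂ) (descendTo F ℰp J (J + 1) (Nat.le_succ J) ⁻¹' B) ≤
            fieldMeasure (F.P (J + 1)) 0 (Matrix.specialUnitaryGroup (Fin 2) ℂ) (descendTo F ℰp J (J + 1) (Nat.le_succ J) ⁻¹' B ∩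
              {V | PlaqSmall (θBal F.L γ (c * b₀) p₀ (J + 1)) V}) := by
  intro L
  obtain ⟨c₀G, hc₀G, -, hG⟩ := interiorSectionCan L
  obtain ⟨c₀R, hc₀R, -, hR⟩ := hrel L
  refine ⟨min (min c₀G c₀R) (1 / 2), lt_min (lt_min hc₀G hc₀R) (by norm_num), (min_le_right _ _).trans (by norm_num), fun c hc hcle => ?_⟩
  have hcG : c ≤ c₀G := hcle.trans ((min_le_left _ _).trans (min_le_left _ _))
  have hcR : c ≤ c₀R := hcle.trans ((min_le_left _ _).trans (min_le_right _ _))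
  have hc1 : c < 1 := lt_of_le_of_lt (hcle.trans (min_le_right _ _)) (by norm_num)
  obtain ⟨pSG, hG⟩ := hG c hc hcG
  obtain ⟨pSR, hR⟩ := hR c hc hcR
  refine ⟨max pSG pSR, fun b₀ p₀ hb₀ hpS hp₀ => ?_⟩
  obtain ⟨γG, hγG, hG⟩ := hG b₀ p₀ hb₀ ((le_max_left _ _).trans hpS) hp₀
  obtain ⟨γR, hγR, hR⟩ := hR b₀ p₀ hb₀ ((le_max_right _ _).trans hpS) hp₀
  obtain ⟨γF, hγF, hF⟩ := hfloor L b₀ p₀ hb₀ hp₀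
  refine ⟨min γG (min γR γF), lt_min hγG (lt_min hγR hγF), fun F γ hFL hγ hγle J => ?_⟩
  have hγG' : γ ≤ γG := hγle.trans (min_le_left _ _)
  have hγR' : γ ≤ γR := hγle.trans ((min_le_right _ _).trans (min_le_left _ _))
  have hγF' : γ ≤ γF := hγle.trans ((min_le_right _ _).trans (min_le_right _ _))
  -- GEOM∘: the margin section
  obtain ⟨r, hr, σ, hσm, hσ⟩ := hG F γ hFL hγ hγG' J
  -- the two letters
  obtain ⟨q₁, hq₁, hrelB⟩ := hR F γ hFL hγ hγR' J r hr σ hσm hσ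
  obtain ⟨q₂, hq₂, hfloorB⟩ := hF F γ hFL hγ hγF' J c hc hc1
  refine ⟨q₁ * q₂, mul_pos hq₁ hq₂, fun B hB hBW => ?_⟩
  have hincl := preimage_inter_tube_subset_window F (W := {U | PlaqSmall (θBal F.L γ (c * b₀) p₀ J) U})
    (θ' := θBal F.L γ (c * b₀) p₀ (J + 1)) (r := r) σ (fun U hU => (hσ U hU).2) hBW
    (histGood F ℰp (θBal F.L γ b₀ p₀) (J + 1) J)
  exact mul_measure_le_inter_of_relTube_floor _ hq₁.le hincl (hrelB B hB hBW) (hfloorB B hB hBW)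

end Knit

/-! ## §4 (v1.1) THE UFL₁ ROAD: a chartwise ABSOLUTE numerator floor + the unguarded upper fibre law ⇒ ⟨SMALL-MASS₁(S′)⟩ -/

section NumFloor

variable (F : T3Family) {J K : ℕ} (hJK : J ≤ K)

/-- ★★ **AN ABSOLUTE NUMERATOR FLOOR FROM A WINDOW CHART**: for `c : WindowChart F hJK Sfine O`, `O` open, `Sfine` and the target `G` measurable, any `W`: if for
`dU_J`-a.e. `U ∈ O ∩ W` the chart's fibre mass of `G ∩ Sfine` is at least `m` — `ofReal m ≤ ∫⁻ 1_{G ∩ Sfine}(c.Φ(U,z))·c.jac(U,z) dU_K(z)` (positivity at a point +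
l.s.c. + compactness, w4-20520 g18's engine ✓`…HaarTubeLscFloor` with a general target) — then `ofReal m·dU_J(B) ≤ dU_K(D_{J,K}⁻¹B ∩ Sfine ∩ G)` for every measurable
`B ⊆ O ∩ W` (px20 g10's chart formula ✓`setLIntegral_preimage_inter_eq_of_fibredChart` at `w = 1`, `T := Sfine ∩ G`). [cite: Balaban1987RG1, (2.10) p.267; Balaban1985Averaging, (10) p.19] -/
theorem numFloor_of_chartwise
    {Sfine : Set (GaugeField (F.P K) 0 (Matrix.specialUnitaryGroup (Fin 2) ℂ))} {O : Set (GaugeField (F.P J) 0 (Matrix.specialUnitaryGroup (Fin 2) ℂ))}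
    (c : WindowChart F hJK Sfine O) (hO : IsOpen O) (hS : MeasurableSet Sfine)
    {G : Set (GaugeField (F.P K) 0 (Matrix.specialUnitaryGroup (Fin 2) ℂ))} (hG : MeasurableSet G)
    (W : Set (GaugeField (F.P J) 0 (Matrix.specialUnitaryGroup (Fin 2) ℂ))) {m : ℝ}
    (hfib : ∀ᵐ U ∂(fieldMeasure (F.P J) 0 (Matrix.specialUnitaryGroup (Fin 2) ℂ)), U ∈ O ∩ W →
      ENNReal.ofReal m ≤ ∫⁻ z, (G ∩ Sfine).indicator (fun _ => (1 : ℝ≥0∞)) (c.Φ (U, z)) * (c.jac (U, z) : ℝ≥0∞)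
        ∂(fieldMeasure (F.P K) 0 (Matrix.specialUnitaryGroup (Fin 2) ℂ))) :
    ∀ B : Set (GaugeField (F.P J) 0 (Matrix.specialUnitaryGroup (Fin 2) ℂ)), MeasurableSet B → B ⊆ O ∩ W →
      ENNReal.ofReal m * fieldMeasure (F.P J) 0 (Matrix.specialUnitaryGroup (Fin 2) ℂ) B ≤
        fieldMeasure (F.P K) 0 (Matrix.specialUnitaryGroup (Fin 2) ℂ) (descendTo F ℰp J K hJK ⁻¹' B ∩ Sfine ∩ G) := by
  intro B hB hBOW
  have hBO : B ⊆ O := fun U hU => (hBOW hU).1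
  have hD : Measurable (descendTo F ℰp J K hJK) := measurable_descendTo F ℰp measurableE_ℰp hJK
  have hT : MeasurableSet (Sfine ∩ G) := hS.inter hG
  -- the chart formula at `w = 1`, `T := Sfine ∩ G`
  have hchart := FluctuationComparisonRegPrIntLTailSupOneChartRows.setLIntegral_preimage_inter_eq_of_fibredChart
    hO.measurableSet hD c.measurable_Φ c.measurable_jac c.descendTo_Φ c.map_Φ (w := fun _ => (1 : ℝ≥0∞)) measurable_const
    hT Set.inter_subset_left hB hBO
  rw [setLIntegral_one] at hchart
  have hset : descendTo F ℰp J K hJK ⁻¹' B ∩ Sfine ∩ G = descendTo F ℰp J K hJK ⁻¹' B ∩ (Sfine ∩ G) := Set.inter_assoc _ _ _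
  rw [hset, hchart, ← setLIntegral_const]
  refine setLIntegral_mono_ae' hB ?_
  filter_upwards [hfib] with U hU hUB
  have h := hU (hBOW hUB)
  -- `(G ∩ Sfine).indicator = (Sfine ∩ G).indicator`
  rw [Set.inter_comm] at h
  exact h

end NumFloor

section Ufl

variable {X Y : Type*} [MeasurableSpace X] [MeasurableSpace Y]

/-- ★ **NUMERATOR FLOOR + UPPER FIBRE LAW ⇒ CHARGE** (measure arithmetic): `ofReal m·μ_J(B) ≤ μ_K(A ∩ S′)` and `μ_K(A) ≤ ofReal C·μ_J(B)` with `0 < C`, `0 ≤ m` give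
`ofReal(m∕C)·μ_K(A) ≤ μ_K(A ∩ S′)`. [folklore] -/
theorem mul_measure_le_inter_of_numFloor_ufl (μK : Measure X) (μJ : Measure Y) {A S' : Set X} {B : Set Y} {m C : ℝ} (hm : 0 ≤ m) (hC : 0 < C)
    (hnum : ENNReal.ofReal m * μJ B ≤ μK (A ∩ S')) (hufl : μK A ≤ ENNReal.ofReal C * μJ B) :
    ENNReal.ofReal (m / C) * μK A ≤ μK (A ∩ S') :=
  calc ENNReal.ofReal (m / C) * μK A ≤ ENNReal.ofReal (m / C) * (ENNReal.ofReal C * μJ B) := mul_le_mul' le_rfl hufl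
    _ = ENNReal.ofReal m * μJ B := by
        rw [← mul_assoc, ← ENNReal.ofReal_mul (div_nonneg hm hC.le), div_mul_cancel₀ m hC.ne']
    _ ≤ μK (A ∩ S') := hnum

end Ufl

section KnitUfl

/-- ★★★ **⟨SMALL-MASS₁(S′)⟩ ⟸ ⟨NUM-FLOOR₁(S′)⟩ + UFL₁** (LEAD w3-20520 g18's road, 06:54:47Z): in the organ's shared shape, an ABSOLUTE numerator floor
«`∃ m₀ > 0`, `ofReal m₀·dU_J(B) ≤ dU_{J+1}(D⁻¹B ∩ S′)` for measurable `B ⊆ W_J(c·b₀)`» (charts: `numFloor_of_chartwise` patched over the closed window) together with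
the UNGUARDED one-step upper fibre law «`∃ C > 0`, `dU_{J+1}(D⁻¹B) ≤ ofReal C·dU_J(B)`» (LEAD's ✓-to-be `…UpperFibreLawOneStep.haar_preimage_descendTo_succ_le`, hypothesis-free —
docks as `fun F J => haar_preimage_descendTo_succ_le F J`) give ⟨SMALL-MASS₁(S′)⟩ TOKEN FOR TOKEN (`q₀ := m₀∕C`).  HONEST SCOPE: a knit; ⟨NUM-FLOOR₁⟩ is the hypothesis.
[cite: Balaban1985Averaging, (10) p.19 and Prop. 1 p.22; Balaban1987RG1, (0.4) p.253 and (2.10) p.267] -/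
theorem smallMassInterior_of_numFloor_ufl
    (hnum : ∀ (L : ℕ), ∃ c₀ : ℝ, 0 < c₀ ∧ c₀ ≤ 1 ∧ ∀ (c : ℝ), 0 < c → c ≤ c₀ → ∃ pS : ℝ, ∀ (b₀ p₀ : ℝ), 0 < b₀ → pS ≤ p₀ → 0 < p₀ →
      ∃ γ₁ : ℝ, 0 < γ₁ ∧ ∀ (F : T3Family) (γ : ℝ), F.L = L → 0 < γ → γ ≤ γ₁ →
        ∀ (J : ℕ), ∃ m₀ : ℝ, 0 < m₀ ∧ ∀ (B : Set (GaugeField (F.P J) 0 (Matrix.specialUnitaryGroup (Fin 2) ℂ))), MeasurableSet B →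
          B ⊆ {U | PlaqSmall (θBal F.L γ (c * b₀) p₀ J) U} →
          ENNReal.ofReal m₀ * fieldMeasure (F.P J) 0 (Matrix.specialUnitaryGroup (Fin 2) ℂ) B ≤
            fieldMeasure (F.P (J + 1)) 0 (Matrix.specialUnitaryGroup (Fin 2) ℂ) (descendTo F ℰp J (J + 1) (Nat.le_succ J) ⁻¹' B ∩
              {V | PlaqSmall (θBal F.L γ (c * b₀) p₀ (J + 1)) V}))
    (hufl : ∀ (F : T3Family) (J : ℕ), ∃ C : ℝ, 0 < C ∧ ∀ B : Set (GaugeField (F.P J) 0 (Matrix.specialUnitaryGroup (Fin 2) ℂ)), MeasurableSet B →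
      fieldMeasure (F.P (J + 1)) 0 (Matrix.specialUnitaryGroup (Fin 2) ℂ) (descendTo F ℰp J (J + 1) (Nat.le_succ J) ⁻¹' B) ≤
        ENNReal.ofReal C * fieldMeasure (F.P J) 0 (Matrix.specialUnitaryGroup (Fin 2) ℂ) B) :
    ∀ (L : ℕ), ∃ c₀ : ℝ, 0 < c₀ ∧ c₀ ≤ 1 ∧ ∀ (c : ℝ), 0 < c → c ≤ c₀ → ∃ pS : ℝ, ∀ (b₀ p₀ : ℝ), 0 < b₀ → pS ≤ p₀ → 0 < p₀ →
      ∃ γ₁ : ℝ, 0 < γ₁ ∧ ∀ (F : T3Family) (γ : ℝ), F.L = L → 0 < γ → γ ≤ γ₁ →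
        ∀ (J : ℕ), ∃ q₀ : ℝ, 0 < q₀ ∧ ∀ (B : Set (GaugeField (F.P J) 0 (Matrix.specialUnitaryGroup (Fin 2) ℂ))), MeasurableSet B →
          B ⊆ {U | PlaqSmall (θBal F.L γ (c * b₀) p₀ J) U} →
          ENNReal.ofReal q₀ * fieldMeasure (F.P (J + 1)) 0 (Matrix.specialUnitaryGroup (Fin 2) ℂ) (descendTo F ℰp J (J + 1) (Nat.le_succ J) ⁻¹' B) ≤
            fieldMeasure (F.P (J + 1)) 0 (Matrix.specialUnitaryGroup (Fin 2) ℂ) (descendTo F ℰp J (J + 1) (Nat.le_succ J) ⁻¹' B ∩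
              {V | PlaqSmall (θBal F.L γ (c * b₀) p₀ (J + 1)) V}) := by
  intro L
  obtain ⟨c₀, hc₀, hc₀1, hc⟩ := hnum L
  refine ⟨c₀, hc₀, hc₀1, fun c hcpos hcle => ?_⟩
  obtain ⟨pS, hpS⟩ := hc c hcpos hcle
  refine ⟨pS, fun b₀ p₀ hb₀ hpS' hp₀ => ?_⟩
  obtain ⟨γ₁, hγ₁, hF⟩ := hpS b₀ p₀ hb₀ hpS' hp₀
  refine ⟨γ₁, hγ₁, fun F γ hFL hγ hγle J => ?_⟩
  obtain ⟨m₀, hm₀, hnumB⟩ := hF F γ hFL hγ hγle J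
  obtain ⟨C, hC, huflB⟩ := hufl F J
  refine ⟨m₀ / C, div_pos hm₀ hC, fun B hB hBW => ?_⟩
  exact mul_measure_le_inter_of_numFloor_ufl _ _ hm₀.le hC (hnumB B hB hBW) (huflB B hB)

end KnitUfl

end Summit.QuantumFields.YangMills.Theorems.FluctuationComparisonRegPrIntLSmallMassOneStep

end
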